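import Literature.FieldTheory.Galois.FixingSubgroupInfimum
import HarnessLib

/-!
# The finite Galois layer `E′ / ⋂ᵢ Eᵢ` inside `ℂ`: it is Galois, and `Gal(E′/⋂ᵢ Eᵢ)` is generated by the `Gal(E′/Eᵢ)`

Topic `Literature/FieldTheory/Galois`, namespace `Literature.FieldTheory.Galois`.  THEOREMS ONLY (no definition, no named
fact, no instance; net debt 0).  Cell `hodgecm-mathlib` (D-0151), row I-6 `descentToIntersection_printed` `_holds` programme
(lead A-p08, DECISIONS OF RECORD 2026-08-28T06:08:26Z, currency (B)), PIECE P2 §3 «glue in the ℂ-currency»: for number fields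
`Eᵢ ⊂ ℂ` (`IntermediateField ℚ ℂ`, finitely many), `E := ⨅ᵢ Eᵢ`, and a finite Galois `E′ ⊂ ℂ` over `ℚ` containing `E`
(§2 of `FixingSubgroupInfimum` supplies one containing every `Eᵢ`), the finite layer is read as
`k := ↥E`, `L := ↥E♯′` with `E♯′ := IntermediateField.extendScalars (hE : E ≤ E′) : IntermediateField ↥E ℂ` — Mathlib's own
`Algebra ↥E ↥E♯′` and `IsScalarTower ↥E ↥E♯′ ℂ`, no hand-rolled algebra structure — and `G := ↥E♯′ ≃ₐ[↥E] ↥E♯′`.  We prove: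
* `Complex.isGalois_extendScalars_iInf` — `E♯′ / E` is Galois (tower top of `E′/ℚ`); `finiteDimensional_extendScalars_iInf`;
* `Complex.gal_extendScalars_iInf_induction` — the WORD PRINCIPLE in exactly the lead's membership currency: a predicate on `G`
  holding at `1`, stable under `*`, and holding for every `γ` with `∀ x : ↥E♯′, (x : ℂ) ∈ Eᵢ → (γ x : ℂ) = x` for SOME `i`,
  holds for all `γ` ([Deligne1971] Lemme 5.10.1: the descent data along the `Gal(E′/Eᵢ)` determine one along `Gal(E′/E)`);
* `Complex.closure_gal_fixing_eq_top` — closure form `Subgroup.closure {γ | ∃ i, γ fixes Eᵢ ∩ E′ pointwise} = ⊤`.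
Proof: the subfields `Kᵢ := Eᵢ ∩ E′` of `E♯′ / E` (as `IntermediateField ↥E ↥E♯′`, the comap of `extendScalars (⨅ ≤ Eᵢ)` along
the inclusion `E♯′ → ℂ`) have `⨅ᵢ Kᵢ = ⊥` because `⨅ᵢ Eᵢ = E`; then §1 (`IntermediateField.gal_induction_of_iInf_eq_bot`).

## References
* [Deligne1971] P. Deligne, *Travaux de Shimura*, Sém. Bourbaki 389, Prop. 5.10 and Lemme 5.10.1 (p. 157).
* [Lang2002] S. Lang, *Algebra*, Ch. VI §1 Thm. 1.2, Cor. 1.6; Thm. 1.10 (Galois over the top of a tower).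
-/

set_option autoImplicit false

namespace Literature.FieldTheory.Galois

open IntermediateField

/-- Membership in an infimum of intermediate fields (Mathlib `IntermediateField.coe_iInf`, pointwise). [folklore] -/
private theorem mem_iInf' {F L : Type*} [Field F] [Field L] [Algebra F L] {ι : Sort*}
    (S : ι → IntermediateField F L) (x : L) : x ∈ (⨅ i, S i) ↔ ∀ i, x ∈ S i := by
  rw [← SetLike.mem_coe, IntermediateField.coe_iInf, Set.mem_iInter]
  simp only [SetLike.mem_coe]

/-- Membership in a comap of intermediate fields (definitional). [folklore] -/
private theorem mem_comap' {F L L' : Type*} [Field F] [Field L] [Field L'] [Algebra F L] [Algebra F L']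
    (f : L →ₐ[F] L') (S : IntermediateField F L') (x : L) : x ∈ S.comap f ↔ f x ∈ S := Iff.rfl

section ComplexLayer

variable {ι : Type*} (E : ι → IntermediateField ℚ ℂ) (E' : IntermediateField ℚ ℂ) (hE : (⨅ i, E i) ≤ E')

/-- The identity of carriers `↥E′ ≃ₐ[ℚ] ↥E♯′` between `E′` and its re-reading `E♯′ = extendScalars hE` as an intermediate field
over `E = ⨅ᵢ Eᵢ` (same subset of `ℂ`, Mathlib `IntermediateField.mem_extendScalars`). [cite: Lang2002, Ch. VI §1 Thm. 1.10] -/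
theorem Complex.nonempty_algEquiv_extendScalars_iInf :
    Nonempty (↥E' ≃ₐ[ℚ] ↥(extendScalars hE)) :=
  ⟨{ toFun := fun x => ⟨x.1, (mem_extendScalars hE).2 x.2⟩
     invFun := fun x => ⟨x.1, (mem_extendScalars hE).1 x.2⟩
     left_inv := fun _ => rfl
     right_inv := fun _ => rfl
     map_mul' := fun _ _ => rfl
     map_add' := fun _ _ => rfl
     commutes' := fun _ => rfl }⟩

/-- **`E′` is finite over `E = ⋂ᵢ Eᵢ`** (it is finite over `ℚ`). [cite: Lang2002, Ch. VI §1 Thm. 1.10] -/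
theorem Complex.finiteDimensional_extendScalars_iInf [FiniteDimensional ℚ E'] :
    FiniteDimensional ↥(⨅ i, E i) ↥(extendScalars hE) := by
  obtain ⟨e⟩ := Complex.nonempty_algEquiv_extendScalars_iInf E E' hE
  haveI : FiniteDimensional ℚ ↥(extendScalars hE) := LinearEquiv.finiteDimensional e.toLinearEquiv
  exact Module.Finite.of_restrictScalars_finite ℚ ↥(⨅ i, E i) ↥(extendScalars hE)

/-- **`E′ / E` is Galois** for `E = ⋂ᵢ Eᵢ ≤ E′` and `E′/ℚ` finite Galois: the top of the tower `ℚ ⊆ E ⊆ E′` of a Galois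
extension is Galois (Mathlib `IsGalois.tower_top_of_isGalois`), transported to the carrier `E♯′ = extendScalars hE`.
[cite: Lang2002, Ch. VI §1 Thm. 1.10] -/
theorem Complex.isGalois_extendScalars_iInf [IsGalois ℚ E'] : IsGalois ↥(⨅ i, E i) ↥(extendScalars hE) := by
  obtain ⟨e⟩ := Complex.nonempty_algEquiv_extendScalars_iInf E E' hE
  haveI : IsGalois ℚ ↥(extendScalars hE) := IsGalois.of_algEquiv e
  exact IsGalois.tower_top_of_isGalois ℚ ↥(⨅ i, E i) ↥(extendScalars hE)

/-- **The traces `Kᵢ = Eᵢ ∩ E′` have intersection `E` inside `E′ / E`**: reading `Eᵢ` as the intermediate field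
`(extendScalars (⨅ ≤ Eᵢ)).comap (val)` of `E♯′ / E` (membership: `(x : ℂ) ∈ Eᵢ`), their infimum is `⊥` — an element of `E′`
lying in every `Eᵢ` lies in `E = ⨅ Eᵢ`, i.e. in the image of `E → E♯′`. [cite: Deligne1971, Prop. 5.10 (E = ⋂ E(G, hᵢ))] -/
theorem Complex.iInf_comap_extendScalars_eq_bot :
    (⨅ i, ((extendScalars (iInf_le E i) : IntermediateField ↥(⨅ i, E i) ℂ).comap (extendScalars hE).val)) = ⊥ := by
  refine le_antisymm (fun x hx => ?_) bot_le
  rw [IntermediateField.mem_bot]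
  have hx' : (x : ℂ) ∈ ⨅ i, E i := by
    rw [mem_iInf']
    intro i
    have hi := ((mem_iInf' _ _).1 hx) i
    rw [mem_comap'] at hi
    exact (mem_extendScalars (iInf_le E i)).1 hi
  refine ⟨⟨(x : ℂ), hx'⟩, Subtype.ext ?_⟩
  rfl

/-- **WORD PRINCIPLE for `Gal(E′/⋂ᵢ Eᵢ)` in the ℂ-currency** ([Deligne1971] Lemme 5.10.1; the lead's membership criterion
`Hᵢ = {γ | ∀ x : ↥E♯′, (x : ℂ) ∈ Eᵢ → (γ x : ℂ) = x}`): with `G := ↥E♯′ ≃ₐ[↥E] ↥E♯′`, `E♯′ = extendScalars hE`, a predicate on `G`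
that holds at `1`, is stable under products, and holds for every `γ` fixing pointwise the trace of SOME `Eᵢ`, holds for every
`γ ∈ G` — because the subgroups `Hᵢ = Gal(E′/Eᵢ ∩ E′)` generate `G` (`⨅ᵢ (Eᵢ ∩ E′) = E` and §1).
[cite: Deligne1971, Lemme 5.10.1 (p. 157)] [cite: Lang2002, Ch. VI §1 Cor. 1.6] -/
theorem Complex.gal_extendScalars_iInf_induction [FiniteDimensional ℚ E'] [IsGalois ℚ E']
    {P : (↥(extendScalars hE) ≃ₐ[↥(⨅ i, E i)] ↥(extendScalars hE)) → Prop} (one : P 1)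
    (mul : ∀ σ τ : ↥(extendScalars hE) ≃ₐ[↥(⨅ i, E i)] ↥(extendScalars hE), P σ → P τ → P (σ * τ))
    (base : ∀ (i : ι) (γ : ↥(extendScalars hE) ≃ₐ[↥(⨅ i, E i)] ↥(extendScalars hE)),
      (∀ x : ↥(extendScalars hE), (x : ℂ) ∈ E i → ((γ x : ↥(extendScalars hE)) : ℂ) = x) → P γ)
    (γ : ↥(extendScalars hE) ≃ₐ[↥(⨅ i, E i)] ↥(extendScalars hE)) : P γ := by
  haveI := Complex.finiteDimensional_extendScalars_iInf E E' hE
  haveI := Complex.isGalois_extendScalars_iInf E E' hE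
  refine IntermediateField.gal_induction_of_iInf_eq_bot
    (fun i => ((extendScalars (iInf_le E i) : IntermediateField ↥(⨅ i, E i) ℂ).comap (extendScalars hE).val))
    (Complex.iInf_comap_extendScalars_eq_bot E E' hE) one mul (fun i σ hσ => base i σ fun x hx => ?_) γ
  have hxK : x ∈ ((extendScalars (iInf_le E i) : IntermediateField ↥(⨅ i, E i) ℂ).comap (extendScalars hE).val) := by
    rw [mem_comap']
    exact (mem_extendScalars (iInf_le E i)).2 hx
  exact congrArg (fun y : ↥(extendScalars hE) => (y : ℂ)) (hσ x hxK)

/-- **Closure form**: the automorphisms of `E′ / E` fixing pointwise the trace of some `Eᵢ` generate `Gal(E′/E)`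
(`E = ⋂ᵢ Eᵢ`). [cite: Deligne1971, Lemme 5.10.1 (p. 157)] [cite: Lang2002, Ch. VI §1 Cor. 1.6] -/
theorem Complex.closure_gal_fixing_eq_top [FiniteDimensional ℚ E'] [IsGalois ℚ E'] :
    Subgroup.closure {γ : ↥(extendScalars hE) ≃ₐ[↥(⨅ i, E i)] ↥(extendScalars hE) |
      ∃ i, ∀ x : ↥(extendScalars hE), (x : ℂ) ∈ E i → ((γ x : ↥(extendScalars hE)) : ℂ) = x} = ⊤ := by
  refine (Subgroup.eq_top_iff' _).2 fun γ => ?_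
  refine Complex.gal_extendScalars_iInf_induction E E' hE (P := fun γ => γ ∈ Subgroup.closure _)
    (Subgroup.one_mem _) (fun σ τ hσ hτ => Subgroup.mul_mem _ hσ hτ) (fun i σ hσ => ?_) γ
  exact Subgroup.subset_closure ⟨i, hσ⟩

/-- **Membership criterion ↔ fixing subgroup**: `γ` fixes the trace of `Eᵢ` pointwise in the ℂ-currency iff `γ` lies in the
fixing subgroup of the intermediate field `Eᵢ ∩ E′` of `E′ / E` (bookkeeping between the lead's `Hᵢ` and Mathlib's
`IntermediateField.fixingSubgroup`). [cite: Lang2002, Ch. VI §1 Thm. 1.2] -/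
theorem Complex.mem_fixingSubgroup_comap_extendScalars_iff (i : ι)
    (γ : ↥(extendScalars hE) ≃ₐ[↥(⨅ i, E i)] ↥(extendScalars hE)) :
    γ ∈ ((extendScalars (iInf_le E i) : IntermediateField ↥(⨅ i, E i) ℂ).comap (extendScalars hE).val).fixingSubgroup ↔
      ∀ x : ↥(extendScalars hE), (x : ℂ) ∈ E i → ((γ x : ↥(extendScalars hE)) : ℂ) = x := by
  rw [IntermediateField.mem_fixingSubgroup_iff]
  constructor
  · intro h x hx
    have hxK : x ∈ ((extendScalars (iInf_le E i) : IntermediateField ↥(⨅ i, E i) ℂ).comap (extendScalars hE).val) := by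
      rw [mem_comap']; exact (mem_extendScalars (iInf_le E i)).2 hx
    exact congrArg (fun y : ↥(extendScalars hE) => (y : ℂ)) (h x hxK)
  · intro h x hx
    rw [mem_comap'] at hx
    exact Subtype.ext (h x ((mem_extendScalars (iInf_le E i)).1 hx))

end ComplexLayer

end Literature.FieldTheory.Galois
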